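import Mathlib

/-!
# SoloBlind kernel #203 — the radiation identity for an evolved flux state

Architecture A5 (PLAN §109 (m)–(n), CLAIMS SB-C1095): the LEMMA R datum is a FLUX STATE,
i.e. a solution `V` of the driven stationary problem `A V = -q` (generator `A`, local
source `q`), and the loop-kernel column is the evolved state `x(B) = e^{B A} V` read at the
injection sites.  Because `V` is stationary under the driven dynamics, its free evolution
changes only by the radiation emitted from the source:

  `d/dB (e^{BA} V) = - e^{BA} q`,   `e^{BA} V = V - ∫₀^B e^{uA} q du`.

When `V = ∫₀^∞ e^{uA} q du` is the outgoing resolvent state this says `x(B) = ∫_B^∞ e^{uA} q du`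
— the radiation still to be emitted — which is how the explicit Bessel form of channel II
(`s₁(B) = V₁ · 2∫_B^∞ J₂(x)dx/x`) arises.  Stated in an arbitrary complete normed algebra
over `ℝ` (matrices of the truncated mode chain included), with `NormedSpace.exp`.
-/

namespace Summit.AnomalousDissipation.AnomalousDissipation.Theorems

open NormedSpace intervalIntegral

variable {𝔸 : Type*} [NormedRing 𝔸] [NormedAlgebra ℝ 𝔸] [CompleteSpace 𝔸]

/-- RADIATION IDENTITY, differential form: if `A V = -q` then the evolved flux state
`u ↦ e^{uA} V` has derivative `-e^{tA} q` at every `t`. -/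
theorem evolvedFlux_hasDerivAt (A V q : 𝔸) (hV : A * V = -q) (t : ℝ) :
    HasDerivAt (fun u : ℝ => exp (u • A) * V) (-(exp (t • A) * q)) t := by
  have h := (hasDerivAt_exp_smul_const A t).mul_const V
  have e : exp (t • A) * A * V = -(exp (t • A) * q) := by rw [mul_assoc, hV, mul_neg]
  rw [← e]
  exact h

/-- The one-parameter family `u ↦ e^{uA}` is continuous (from its differentiability). -/
theorem continuous_exp_smul (A : 𝔸) : Continuous (fun u : ℝ => exp (u • A)) :=
  continuous_iff_continuousAt.mpr (fun u => (hasDerivAt_exp_smul_const A u).differentiableAt.continuousAt)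

/-- RADIATION IDENTITY, integrated form: if `A V = -q` then for every `B`,
`e^{BA} V = V - ∫₀^B e^{uA} q du` — the evolved flux state equals the flux state minus the
radiation emitted from the source during `[0, B]`. -/
theorem evolvedFlux_eq_sub_integral (A V q : 𝔸) (hV : A * V = -q) (B : ℝ) :
    exp (B • A) * V = V - ∫ u in (0:ℝ)..B, exp (u • A) * q := by
  have hderiv : ∀ u ∈ Set.uIcc (0:ℝ) B,
      HasDerivAt (fun u : ℝ => exp (u • A) * V) (-(exp (u • A) * q)) u :=
    fun u _ => evolvedFlux_hasDerivAt A V q hV u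
  have hcont : Continuous (fun u : ℝ => -(exp (u • A) * q)) :=
    ((continuous_exp_smul A).mul continuous_const).neg
  have hint := integral_eq_sub_of_hasDerivAt hderiv (hcont.intervalIntegrable 0 B)
  -- ∫₀^B -(e^{uA} q) du = e^{BA} V - e^{0·A} V
  simp only [zero_smul, NormedSpace.exp_zero, one_mul, intervalIntegral.integral_neg] at hint
  calc exp (B • A) * V = V + (exp (B • A) * V - V) := by abel
    _ = V + -(∫ u in (0:ℝ)..B, exp (u • A) * q) := by rw [← hint]
    _ = V - ∫ u in (0:ℝ)..B, exp (u • A) * q := by abel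

/-- Consequence for bounds (the form used in the read-out estimates): the deviation of the
evolved flux state from the flux state is controlled by the emitted radiation,
`‖e^{BA} V - V‖ ≤ ∫₀^B ‖e^{uA} q‖ du` for `B ≥ 0`. -/
theorem norm_evolvedFlux_sub_le (A V q : 𝔸) (hV : A * V = -q) {B : ℝ} (hB : 0 ≤ B) :
    ‖exp (B • A) * V - V‖ ≤ ∫ u in (0:ℝ)..B, ‖exp (u • A) * q‖ := by
  rw [evolvedFlux_eq_sub_integral A V q hV B, sub_sub_cancel_left, norm_neg]
  exact intervalIntegral.norm_integral_le_integral_norm hB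

end Summit.AnomalousDissipation.AnomalousDissipation.Theorems
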